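import Mathlib
import HarnessLib
import HarnessLib.Audit
import Summits.QuantumFields.Statement
import HarnessLib.Audit.Status.Attr

/-!
Route: QuarksNoInfraredClause

DORMANT since 2026-08-29T21:02:42Z (census g0: costume (trib-confirmed census-trib-costume-A 2026-08-29; 21-frontier 19:16:23Z (b)); reversible --off) — unstaffed, not closed; items shared with open routes are served there. `ledger route dormant <id> --off` reactivates.

# Route QuarksNoInfraredClause — Quarks add no infrared clause — QCD from a neutral-sector lattice
gap plus UV-visible non-degeneracy, via the torus half-spectrum lemma and limit glue

It suffices to show X = HALF ∧ W₂ ∧ W₃ ∧ THIN (card QuantumFields/QCD/quarks-add-no-infrared-clause,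
absorbing its retired duplicate soft-clauses-from-the-ultraviolet). THIN (`ThinQCD`) is `QCDOf 2 ∧
QCDOf 3` with two changes: (a) the all-pairs lattice clause `HasLatticeMassGap Δ` (Wilson loops, ALL
mesons, ALL baryons) is replaced by the same clustering bound for FLAVOUR-NEUTRAL pairs only
(observables invariant under the exact vector torus U(1)^{N_f}: ψ_f ↦ t_f ψ_f, ψ̄_f ↦ t_f⁻¹ ψ̄_f —
baryon number and every flavour charge zero), at rate 2Δ; (b) the three soft clauses `IsNontrivial
glue`, `IsNonGaussian glue`, `∀ f ≠ g, IsNontrivial (pseudoRe f g)` are replaced by their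
lattice-side form: connected 2- and 3-point functions of the renormalised smeared lattice fields at
ONE configuration of time-separated real bumps stay bounded away from 0 along the scheme (what a
UV/perturbative-window analysis outputs). Statement re-type 2026-08-16 (p117723): `QCDOf` gained the
conjunct `reg.IsChiralAtZero` (for every ε > 0 some POSITIVE mass tuple has no uniform lattice gap ε
— the lattice gap closes as m → 0⁺, pinning the additive offset of m_crit to the chiral point) and
THIN carries it VERBATIM inside its ∃ reg: it must share THIN's witness (a regularisation whose
m_crit hides an offset M₀ > 0 is useless for the re-typed `QCDOf`), it is not derivable from the
other items, and it is deliberately NOT thinned — it is a NO-gap clause, witnessed by any ONE pair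
of local observables (flavoured pions allowed), so the half-spectrum lemma plays no role in it. It
is the one quark-specific infrared clause this line does not absorb: an UPPER bound on a mass
(Goldstone physics), not a gap. HALF (`TorusHalfSpectrum`, rank 2) is the torus-uniform
half-spectrum lemma for the tree's lattice QCD functional: in the positivity range (β_k → +∞, κ <
1/6) neutral-pair clustering at rate 2Δ on all tori S ≥ L_k implies ALL-pair clustering at rate Δ —
a light state in any flavoured/baryonic sector forces its particle–antiparticle pair, at most twice
as heavy, into the neutral sector (spectrum additivity read contrapositively; RP + exact flavour
symmetry + hypercubic symmetry; blind to the sign of det). W₂, W₃ (`TwoPointWitness`,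
`ThreePointWitness`, support) pass the lattice-side non-degeneracy through `IsQCDAlong` to
`IsNontrivial` / `IsNonGaussian` (Schwartz-tensor bookkeeping — PROVED inside the deciding theorem
since rev 9). Net: every quark-specific infrared GAP obligation of `QCDOf` (flavoured and baryonic
clustering, non-decoupling) is bookkeeping; what remains is existence with UV-visible
non-degeneracy, ONE neutral-sector gap, and the chiral endpoint.
Lean: `TorusHalfSpectrum ∧ ThinQCD` (the two cruxes; `TwoPointWitness` and `ThreePointWitness` are
proved support decls; the deciding theorem `closes : TorusHalfSpectrum → ThinQCD → QCD` is crux-only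
— rev 9, axioms propext / Classical.choice / Quot.sound)

## Assembly
Theorem `closes : TorusHalfSpectrum → ThinQCD → QCD` (crux-only; the limit glue is proved inside it
as `have h₃ : TwoPointWitness`, `have h₄ : ThreePointWitness` — Schwartz tensors of real bumps in
pairwise disjoint time slabs are off-diagonal by the support criterion, `IsQCDAlong` identifies the
n = 1, 2, 3 limits, `ge_of_tendsto` makes an eventually-≥ ε sequence converge to a non-zero limit,
and the OS adjoint of the reflected bump Θf is the tensor of f itself): for N_f ∈ {2, 3} take reg
from ThinQCD together with `HasMassScaling` and `IsChiralAtZero`; for each m take its z, shift, T,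
Δ; `IsQCDAlong` is kept; TwoPointWitness turns the glue and pseudoRe 2-point bounds into
`IsNontrivial glue` and `∀ f ≠ g, IsNontrivial (pseudoRe f g)`; ThreePointWitness gives
`IsNonGaussian glue`; `T.HasMassGap Δ` is kept; TorusHalfSpectrum (fed `0 < Δ`, `0 < betaCoeff₀ N_f`
by `unfold; positivity`, and the two first conjuncts of `IsQCDAlong`) turns neutral clustering at 2Δ
into `HasLatticeMassGap Δ`. Hence `QCDOf 2 ∧ QCDOf 3 = QCD`.

Rationale: WHY THIS LINE. The mechanism is Haag's additivity of the energy–momentum spectrum (Haag1996 Thm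
II.5.4.1: p₁, p₂ ∈ Spec ⇒ p₁ + p₂ ∈ Spec, from products of almost-local operators plus qualitative
clustering) transplanted to Lüscher's positive transfer matrix for Wilson fermions
(doi:10.1007/bf01614090; OsterwalderSeiler1978 §§2–4) and pointed at the COMPACT ABELIAN flavour
torus: for an observable A of flavour weight q ≠ 0 the product A(0)·A†(x) is neutral, its RP
two-point function is bounded by ‖Â‖⁴e^{−2Δt}, and spatial splitting |x| → ∞ (mixing of neutral
4-point functions, from the neutral hypothesis itself by hypercubic symmetry) leaves c_A(t)² — so
c_A(t) ≤ ‖Â‖² e^{−Δt}: no group averaging and no multiplet dimension is needed because the vector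
flavour group is abelian on charge components, and Grassmann-odd (baryonic) A are covered by
fermionic RP. Imported area: algebraic QFT spectral theory (Haag–Araki) into constructive lattice
gauge theory; the QCD-inequality literature (Weingarten doi:10.1103/physrevlett.51.1830,
Vafa–Witten, Nussinov–Lampert doi:10.1016/s0370-1573(01)00091-6) compares hadron masses but never
states "the flavoured half of the gap clause follows from the neutral half", and no pool card or
route files it for QCD (YangMills support card half-spectrum-channel-subadditivity: finite group K,
pure gauge). The UV side keeps the card's reading — non-decoupling is the FINITENESS of a mass (RP
log-convexity: the effective mass between τ₀ and 2τ₀ caps the flavoured mass; GlimmJaffe1987 §6.1)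
and `IsNonGaussian glue` is tree-level through the m-odd free-quark triangle of the singlet scalar
density the plaquette mixes with (statement docstring audit g3 N1; MontvayMunster1994 §5.1) — but
files only its checkable output (lattice-side non-degeneracy at one scale) plus the limit glue,
because the tree has no perturbative-window vocabulary yet. Negatives index: empty for QuantumFields
(ledger negatives, 2026-08-15).

RANKED CRUXES. #0 Thesis (target) — X = HALF ∧ W₂ ∧ W₃ ∧ THIN as in § Thesis (the conjunction of the
four decls of this route). (why it might fail: THIN contains unquenched existence and the
neutral-sector gap (open); HALF may hold only in infinite volume (torus return is thermal
bookkeeping).) [JaffeWitten2000 §5, Haag1996 Thm II.5.4.1, doi:10.1007/bf01614090]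
#2 TorusHalfSpectrum (crux) — TORUS-UNIFORM HALF-SPECTRUM (card item (i)/K3/P1). For every N_f with
b₀ > 0, every sequential scheme sch with two-loop asymptotic scaling (so β_k → +∞: gauge RP range)
and bare masses eventually on the physical branch m_f(k) > −1 (κ < 1/6: Lüscher positivity), and
every Δ > 0: if every pair of FLAVOUR-NEUTRAL gauge-invariant local observables (A, B invariant
under ψ_f ↦ t_f ψ_f, ψ̄_f ↦ t_f⁻¹ ψ̄_f for all t ∈ (ℂˣ)^{N_f}) clusters in Euclidean time at rate 2Δ
in physical units with the quantifier shape of `HasLatticeMassGap` (∃ C, eventually in k, on every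
torus 2S+1 ≥ 2L_k+1, all n ≤ S), then `sch.HasLatticeMassGap Δ` (ALL pairs: flavoured mesons,
baryons, …). Ranked 2 as the most informative item: proved, it halves the gap clause of every QCD
(and, mutatis mutandis, YangMills) route; refuted torus-uniformly, the design rule dies.
[difficulty: XL] (why it might fail: Per-pair constants of the neutral hypothesis do not bound the
x-dependent products A·τ_xA† uniformly; on symmetric tori the (−1)^F-twisted trace needs its own
spectral/thermal bookkeeping (torus-clause-is-thermal-v2); fermionic RP for the tree's functional is
unbuilt.) [Haag1996 Thm II.5.4.1 p.115, doi:10.1007/bf01614090, OsterwalderSeiler1978 §§2–4,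
GlimmJaffe1987 §6.1 and §19, JaffeWitten2000 §5,
QuantumFields/YangMills/half-spectrum-channel-subadditivity,
QuantumFields/YangMills/torus-clause-is-thermal-v2]
#3 ThinQCD (crux) — THE THIN CONJUNCT (card NET; re-typed with the Statement 2026-08-16, p117723).
For N_f = 2 and N_f = 3: one mass-independent regularisation reg with `HasMassScaling` and
`IsChiralAtZero` (chiral endpoint, verbatim from `QCDOf`: for every ε > 0 some positive mass tuple m
has `¬ (reg.scheme m 0 0).HasLatticeMassGap ε`) such that for every tuple m_f > 0 there are z, shift
and OS data T with `IsQCDAlong (reg.scheme m z shift) T`; lattice-side UV non-degeneracy — for the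
renormalised smeared `glue` field and for each `pseudoRe f₁ f₂` (f₁ ≠ f₂) a pair of real bumps f
(times < 0), g (times > 0) whose connected lattice 2-point function stays ≥ ε > 0 eventually in k,
and for `glue` a triple f, g, h in the time slabs (−∞,0), (0,1), (1,∞) whose connected lattice
3-point function stays ≥ ε; and one Δ > 0 with `T.HasMassGap Δ` and FLAVOUR-NEUTRAL lattice
clustering at rate 2Δ (the neutral restriction of `HasLatticeMassGap`). This is `QCDOf` with every
flavoured/baryonic lattice obligation removed and the soft clauses in the form a perturbative-window
analysis delivers them (the card's K1 window bound + log-convexity squeeze ⇒ the 2-point bounds;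
K1(b) + K2 mixing dominance + the m-odd quark triangle ⇒ the 3-point bound). [difficulty:
open-problem] (why it might fail: It still contains unquenched existence with k-uniform control of
composite 2- /3-point functions at one physical scale (Bałaban controls actions, not observables) AND
the neutral 0⁺ gap — both open — AND now the chiral endpoint (gap → 0 as m → 0⁺: Goldstone physics
for Wilson quarks, which have no exact chiral symmetry at finite a); the 3-point clause bets on
plaquette→ψ̄ψ mixing dominance (c₃(g₀) ≠ 0).) [JaffeWitten2000 §1 and §5, MontvayMunster1994 §5.1
and p.239 (5.59)–(5.60),
Literature.MathematicalPhysics.QuantumFieldTheory.QCDRegularisation.IsChiralAtZero,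
doi:10.1007/jhep02(2011)051, doi:10.1007/bf01217763, doi:10.1016/s0370-1573(01)00091-6,
QuantumFields/QCD/gradient-flow-species, QuantumFields/QCD/femto-universe-step-scaling,
QuantumFields/QCD/lcp-tangent-response-soft-clauses]
#9 TwoPointWitness (support) — LIMIT GLUE FOR NON-TRIVIALITY (card P2(b)). For any scheme, OS data
and species s: `IsQCDAlong sch T` and the lattice-side 2-point non-degeneracy of s (real bumps f at
negative, g at positive times; connected lattice 2-point function ≥ ε eventually) imply
`T.IsNontrivial s`. Proof plan: F := tensorFin 1 (ofRealTest (f ∘ θ)), G := tensorFin 1 (ofRealTest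
g) are time-ordered; osAdjoint F is the tensor of ofRealTest f (f real); appendTensor gives H with
IsAppendTensorOf; disjoint closed time supports make f ⊗ g off-diagonal; IsQCDAlong (n = 1, 2)
identifies the limits, and a sequence eventually ≥ ε in norm has a non-zero limit. PROVED inside
`closes` (rev 9); a standalone Theorems file (twoPointWitness_proof / threePointWitness_proof /
assembly_proof, lean check rc 0) is attached as item evidence for a prover to land. [difficulty:
provable-now] [OS1973 §2, GlimmJaffe1987 §6.1,
Literature.MathematicalPhysics.QuantumLattice.exists_isTensorOf]
#9 ThreePointWitness (support) — LIMIT GLUE FOR NON-GAUSSIANITY (card P2(c)). For any scheme, OS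
data and species s: `IsQCDAlong sch T` and the lattice-side connected 3-point non-degeneracy of s
(real bumps in the slabs x⁰ < 0, 0 < x⁰ < 1, 1 < x⁰; κ₃ combination ≥ ε eventually) imply
`T.IsNonGaussian s` (witnesses: ofRealTest f, g, h and their tensorFin tensors; pairwise disjoint
closed supports give off-diagonality of the 3- and 2-tensors; IsQCDAlong for n = 1, 2, 3). PROVED
inside `closes` (rev 9); same evidence file. [difficulty: provable-now] [OS1973 §2, GlimmJaffe1987
§6.1 (truncated functions), Literature.MathematicalPhysics.QuantumLattice.isTensorOf_tensorFin]

TWO-LAYER PLAN. Foreseen glued splits (none filed now; k ≤ 3, depth 1). TorusHalfSpectrum ⇐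
InfiniteVolumeHalfSpectrum (S → ∞ first at fixed k: fermionic RP + spectral measures + additivity,
the clean Haag-type theorem) → TorusReturn (symmetric-torus spectral/thermal bookkeeping shared with
YangMills card torus-clause-is-thermal-v2) → TorusHalfSpectrum. ThinQCD ⇐ UVExistenceWindow (reg,
and for every m: z, shift, T with IsQCDAlong + the lattice-side 2- /3-point non-degeneracy — the
card's K1 LOShortDistanceWindow and K2 MixingDominance live here, to be typed once a
perturbative-window vocabulary exists) → NeutralGap (for the SAME reg: T.HasMassGap Δ ∧ neutral
lattice clustering at 2Δ — the Yang–Mills-hard core, fed by whichever IR engine lands: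
heavier-quarks-never-refine, heavy-threshold-robust-ym-bridge, femto-universe-step-scaling) →
ChiralEndpoint (for the SAME reg: `reg.IsChiralAtZero` — at fixed k the clause `HasLatticeMassGap ε`
quantifies over all tori S ≥ L_k and all n ≤ S, so it is denied by a lattice mass below ε in
physical units with a k-uniform residue frequently in k; the flavoured pion correlator at small
positive RGI masses is the natural witness, m_π² ∝ m_q, MontvayMunster1994 §5.1 p.239) → ThinQCD,
the glue being the shared-witness bookkeeping (all three children must be stated over one reg, which
is why they are not separate cruxes now).

KILL CRITERIA. A torus-uniform counterexample to TorusHalfSpectrum inside the positivity range (an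
RP, flavour-symmetric lattice QCD scheme with neutral clustering at 2Δ but a flavoured/baryonic pair
not clustering at Δ with S-uniform constants) closes the route `refuted:TorusHalfSpectrum` — the
design rule is then false as a rule and every QCD route must keep its flavoured clauses. A
refutation confined to finite tori (infinite-volume version surviving) forces a pivot: restate with
the torus-return hypothesis of torus-clause-is-thermal-v2 made explicit. ThinQCD refuted through its
3-point clause (plaquette κ₃ → 0 along every honest scheme, e.g. an accidental zero of the mixing
coefficient) forces a pivot of that clause to the NLO tr F² form (YangMills card
free-glue-cubically-gaussian-selection-rule); ThinQCD refuted through the neutral gap or existence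
kills QCD itself, not this line; likewise a refutation through the chiral clause (no honest Wilson
regularisation both chiral at zero and massive-with-gap for every m > 0, e.g. an Aoki/first-order
obstruction surviving in physical units along every asymptotically scaling scheme) refutes the
re-typed `QCDOf`, not the thinning. QCD proved elsewhere moots the route; TorusHalfSpectrum stays
valuable as shared support.

NOT DECOMPOSED YET. Deliberately not filed at open: (1) the card's K1 (O(1)-factor window bound
sup_k C_k(τ₀/a_k)/C_k(2τ₀/a_k) < ∞ for slab correlators of plaquette and P_fg, and leading-order
3-point control) and K2 (mixing dominance z(k)(P − shift_k) → c·S⁰_R, c ≠ 0) — they are HOW a UV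
construction meets ThinQCD's lattice-side clauses, need lattice-perturbation-theory vocabulary the
tree lacks, and become children of ThinQCD's UV split; (2) the RP lemmas behind the card's (ii)
(Stieltjes form of slab-summed RP-diagonal correlators, log-convexity, monotone effective mass) —
provers attach them with `--supports ThinQCD`/`TorusHalfSpectrum`, they are not items; (3) the
continuum half-spectrum (neutral-string gap ⇒ `T.HasMassGap` at half rate via E4) and the
lattice→continuum gap transfer — `T.HasMassGap Δ` is kept verbatim inside ThinQCD because species
labels `pseudoRe/pseudoIm` do not carry definite flavour charge and because smeared renormalised
fields are not local observables (hidden-light-state loophole for slowly growing volumes); (4)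
fermionic OS positivity / Lüscher's transfer matrix for the tree's `qcdTorusExpect` (requested below
as a named fact); (5) any split by flavour number; (6) the chiral endpoint's engine (a
Goldstone/GMOR-type lower bound on the flavoured pseudoscalar correlator at small RGI mass — Wilson
quarks have no exact lattice chiral symmetry, so it goes through Ward identities up to O(a) or the
continuum limit) — it stays inside ThinQCD until an engine card exists.

CHEAPEST FALSIFIER. For HALF: the factor ½ is sharp (2D Ising: even sector starts at exactly 2m; in
QCD with light quarks the neutral 0⁺⁺ threshold is 2m_π, so m_π = Δ₀/2 saturates) — any claimed
improvement is false, and dropping flavour-invariance of the STATE (a non-mixing mixture) hides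
light charged modes; both checked by hand. The one lookup that would shrink HALF to infinite volume:
a derivation in Seiler1982 Ch. 2–3 / OsterwalderSeiler1978 §3 of symmetric-torus uniformity from the
infinite-volume gap alone (the YangMills card torus-clause-is-thermal-v2 looked and found none; lit
services were unavailable in this session, logged). For THIN's 3-point clause: evaluate the free
massive Wilson-quark triangle −2 Re tr[G₁₂G₂₃G₃₁] of ψ̄ψ at three time-separated slabs for am ∈
{0.05, 0.2, 0.5} on an 8³×16 lattice (exact, numpy; queued as a kit job if compute is reachable,
result to be attached as evidence to ThinQCD) — identically zero would kill the tree-level discharge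
(the m³Δ₁Δ₂Δ₃ term forbids it in the continuum).

NUMBERS. b₀(2) = (29/3)/(16π²) ≈ 0.0612 > 0, b₀(3) = 9/(16π²) ≈ 0.0570 > 0 (tree `betaCoeff₀`; the
hypothesis `0 < betaCoeff₀ N_f` of HALF, i.e. N_f ≤ 16). Positivity range of Lüscher's transfer
matrix: r = 1, κ < 1/6 ⟺ m₀ > −1 (MontvayMunster1994 (4.111)) = the `IsQCDAlong` branch condition.
Sharpness of ½: Ising d = 2 even/odd sectors 2m : m; QCD: 2m_π± ≈ 279 MeV vs lightest
flavour-singlet scalar threshold 2m_π⁰ ≈ 270 MeV (isospin breaking aside, saturation). Items at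
open: 6 (1 target, 2 cruxes, 2 support, 1 assembly); after the 2026-08-16 repair: 5 (2 cruxes, 2
support proved inside `closes`, 1 assembly), deciding theorem crux-only (rev 9).

DEFINITION REQUESTS. (1) cite/fact: "Lüscher 1977 (doi:10.1007/bf01614090) / Osterwalder–Seiler 1978
§§2–4: for r = 1 Wilson fermions with κ < 1/6 coupled to the Wilson SU(3) action with β ≥ 0, the
lattice QCD functional is site-reflection positive on the Grassmann–gauge algebra and has a positive
self-adjoint transfer matrix; the tree's time-periodic `qcdTorusExpect` is the (−1)^F-twisted trace
Str(T^{2S+1}·)/Str(T^{2S+1})" — wanted as a named `def … : Prop` in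
Literature/MathematicalPhysics/QuantumFieldTheory so that provers of TorusHalfSpectrum can take it
as a hypothesis `(h : …)` in supports. (2) definition: `QCDLatticeObservable.IsFlavourNeutral`
(invariance under the (ℂˣ)^{N_f} scaling ψ_f ↦ t_f ψ_f, ψ̄_f ↦ t_f⁻¹ ψ̄_f of the boxed Grassmann
generators, exactly the inline predicate of TorusHalfSpectrum) and
`QCDScheme.HasNeutralLatticeMassGap`, next to `QCDScheme.HasLatticeMassGap` in QCDOS.lean — so later
items can be short. Both to be filed with `ledger workitem add` after open.

Novelty: Searches (2026-08-15, this session): all 39 + 28 QCD and 46 + 32 YangMills idea cards (open +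
closed) grepped for "half-spectrum | spectrum additivity | neutral-sector gap | twice as heavy" —
hits: this card, its retired duplicate soft-clauses-from-the-ultraviolet,
isospin-never-phase-separates (cites this card's (i) as input), YangMills
half-spectrum-channel-subadditivity (finite K, pure gauge; graded variant),
torus-clause-is-thermal-v2 / os-legs-fine-print / compactness-rigidity-ir-liouville /
weyl-even-invisible-coulomb-phase (cite the YM support card; none for quarks); `ledger negatives
--problem QuantumFields` (0 refuted statements); `lean search` over Literature for fermionic
reflection positivity / transfer matrix for Wilson fermions (none: GrassmannIntegral, wilsonDirac,
QCDOS only) — so HALF has no in-tree precursor; `lit search --hybrid "additivity of the energy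
momentum spectrum cluster property two-particle threshold charged sector"`, `lit vsearch "a charged
particle lighter than half the mass gap of the neutral sector is impossible"`, `lit search "QCD
inequalities Weingarten Vafa Witten mass inequalities flavour non-singlet" --source local` — all
three returned "service unavailable (off-box, D-0023)" twice in this session (logged in NOTES.md);
relied on the card's searches (crossref QCD-inequality family, `lit frontier QuantumFields --since
2021`, 36 QCD cards read) and the refuter novelty audit of 2026-08-15T13:21Z (Haag1996 p.115 read;
Montvay–Münster §7.2 eff  [refs: 10.1007/bf01614090, 10.1103/physrevlett.51.1830, 10.1016/s0370-1573(01, doi:10.1007/bf01614090, doi:10.1103/physrevlett.51.1830, doi:10.1016/s0370-1573, Haag1996]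

Barriers (technique_class: rp-spectral-reduction, spectrum-additivity, clause-thinning): - technique_class: rp-spectral-reduction, spectrum-additivity, clause-thinning
- Literature.Barriers.QuantumFields.FixedCouplingUltralocality: respected — nothing is concluded at
fixed coupling; HALF is stated along asymptotically scaling schemes in physical units (rate
Δ·a_k·n), and ThinQCD's UV clauses sit at one PHYSICAL scale.
- Literature.Barriers.QuantumFields.PerturbativeInvisibility: respected — perturbation theory is
invoked (informally, inside ThinQCD's UV clauses) only for non-vanishing statements and upper bounds
on masses; the gap Δ is never extracted from it.
- Literature.Barriers.QuantumFields.WilsonDeterminantSign: evaded structurally — HALF uses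
reflection positivity of the joint Grassmann–gauge functional and the positive transfer matrix (κ <
1/6), which hold for signed determinants and odd N_f; no positivity of the gauge marginal is used,
so N_f = 3 with split masses is covered verbatim.
- Literature.Barriers.QuantumFields.WilsonDeterminantMassSplitting: same — no pathwise or
probabilistic bound on det ratios enters.
- Literature.Barriers.QuantumFields.HoppingExpansionUniformGap: not engaged — no expansion in κ;
HALF and ThinQCD are stated at every positive renormalised mass.
- Literature.Barriers.QuantumFields.AokiPhaseDichotomy: consistent — HALF uses only the EXACT vector
flavour torus of the finite-volume functional; where flavour/parity breaks spontaneously at finite a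
(Aoki phase) the neutral sector is gapless too (Goldstone pairs), so the implication

Novelty grade: variant — route-review grade (refuter-rreview-0815T13-25-0): VARIANT. Prior art (held, read this session): Haag 1996 Thm II.5.4.1 p.116 (additivity of the energy–momentum spectrum: almost-local operators + cluster property) and §IV.3 (IV.3.5) p.194 (Spect U ⊃ Spect U + Spect U₀ across superselection sectors,  (refuter refuter-rreview-0815T13-25-0, 2026-08-15T14:51:22Z; prior: Haag1996:ThmII.5.4.1,Haag1996:IV.3.5,doi:10.1007/bf01614090,OsterwalderSeiler1978,doi:10.1103/physrevlett.51.1830,doi:10.1016/s0370-1573(01)00091-6)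

History (route lifecycle, newest last):
- 2026-08-15T14:24:32Z · rev 1: dropped Thesis — drop the optional rank-0 target item: its signature is the bare conjunction of the four item decls and, rendered first (rank 0), cannot elaborate before them (g (planner-plancard-QuantumFields-QCD-quarks-add-33ec0fd8-0)
- 2026-08-16T23:12:19Z · rev 8: restated ThinQCD (stmt-QuantumFields-9509) — route-repair (statement-revised p117723: QCDOf gained reg.IsChiralAtZero): restate ThinQCD 1:1 (same decl; THIN tracks the re-typed QCDOf by design) inserting ` (planner-rrepair-QuantumFields-QuarksNoInfrared-f87166e3-0)
- 2026-08-26T00:41:42Z · DORMANT — reconciler: no traction for 8.2 d (last activity item-evidence-added at 2026-08-17T19:19:54Z); parked, not closed — `ledger route dormant route-QuantumFields-Qu (operator:999:3556388)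
- 2026-08-28T19:30:46Z · REACTIVATED — reconciler: reactivated — activity statement-closed at 2026-08-28T17:27:38Z after parking at 2026-08-26T00:41:42Z (operator:999:3092712)
- 2026-08-29T21:02:42Z · DORMANT — census g0: costume (trib-confirmed census-trib-costume-A 2026-08-29; 21-frontier 19:16:23Z (b)); reversible --off (operator:999:1771320)

sub-problem: QCD · status: dormant · opened planner-plancard-QuantumFields-QCD-quarks-add-33ec0fd8-0 2026-08-15T13:59:19Z · rev 11 · ledger route-QuantumFields-QuarksNoInfraredClause
GENERATED by the gate from the ledger (D-0016/17). Provers cite these decls: `theorem foo : Summit.QuantumFields.QCD.Theses.QuarksNoInfraredClause.<Decl> := …` in Summits/QuantumFields/QCD/Theorems/<Name>.lean.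
-/

namespace Summit.QuantumFields.QCD.Theses.QuarksNoInfraredClause

open scoped BigOperators Topology Manifold Classical MeasureTheory ProbabilityTheory Matrix InnerProductSpace ComplexConjugate ContinuousMap
open Filter Set Function TopologicalSpace MeasureTheory

attribute [summit_statement] _root_.QCD

/-- item stmt-QuantumFields-9508 · crux · rank 2 · open · by planner
why it might fail: Hypothesis is pair-by-pair (∃C, ∀ᶠk; no uniformity): additivity at step k needs the split composites A·τ_xĀ for |x| ≫ 1/(a_kΔ) → ∞ — infinitely many neutral pairs, no common threshold; plus the (−1)^F-twisted symmetric-torus trace (n ≤ S), k-uniform ‖ÂΩ‖, and fermionic RP for qcdTorusExpect unbuilt.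
sources: Haag1996 Thm II.5.4.1 (additivity of the energy–momentum spectrum; lit PDF p.116) and §IV.3 (IV.3.5) (sector version; PDF p.194), doi:10.1007/978-3-642-70307-2_11 (Borchers–Buchholz 1985, spectrum additivity without Lorentz symmetry — the lattice-translation form of the infinite-volume half), Luscher1977 = doi:10.1007/bf01614090 (positive transfer matrix for Wilson fermions), MontvayMunster1994 §4.1 (4.111) (site-RP r = 1, |κ| < 1/6; link-RP for all κ; lit PDF p.184), OsterwalderSeiler1978 §§2–4, paper:arxiv-hep-ph_9911532 = doi:10.1016/s0370-1573(01)00091-6 (Nussinov–Lampert, QCD inequalities: 2m_{ij̄} ≥ m_{iī}+m_{jj̄} only heuristic, PDF p.14; rigorous Weingarten-type bounds run the other way)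
[crux] TORUS-UNIFORM HALF-SPECTRUM (card item (i)/K3/P1). For every N_f with b₀ > 0, every
sequential scheme sch with two-loop asymptotic scaling (so β_k → +∞: gauge RP range) and bare masses
eventually on the physical branch m_f(k) > −1 (κ < 1/6: Lüscher positivity), and every Δ > 0: if
every pair of FLAVOUR-NEUTRAL gauge-invariant local observables (A, B invariant under ψ_f ↦ t_f ψ_f,
ψ̄_f ↦ t_f⁻¹ ψ̄_f for all t ∈ (ℂˣ)^{N_f}) clusters in Euclidean time at rate 2Δ in physical units
with the quantifier shape of `HasLatticeMassGap` (∃ C, eventually in k, on every torus 2S+1 ≥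
2L_k+1, all n ≤ S), then `sch.HasLatticeMassGap Δ` (ALL pairs: flavoured mesons, baryons, …). Ranked
2 as the most informative item: proved, it halves the gap clause of every QCD (and, mutatis
mutandis, YangMills) route; refuted torus-uniformly, the design rule dies. [difficulty: XL] -/
@[route_item "route-QuantumFields-QuarksNoInfraredClause", crux]
def TorusHalfSpectrum : Prop :=
  open Literature.MathematicalPhysics.QuantumFieldTheory in ∀ (Nf : ℕ) (sch : QCDScheme Nf) (Δ : ℝ), 0 < Δ → 0 < betaCoeff₀ Nf → sch.HasAsymptoticScaling → (∀ fl : Fin Nf, ∀ᶠ k in Filter.atTop, -1 < sch.mq fl k) → (∀ (R R' : ℕ) (A : QCDLatticeObservable Nf R) (B : QCDLatticeObservable Nf R'), (∀ t : Fin Nf → ℂ, (∀ f, t f ≠ 0) → ∀ U, ExteriorAlgebra.map (LinearMap.pi fun w : BoxFermiIdx Nf R ⊕ₗ BoxFermiIdx Nf R => (match ofLex w with | Sum.inl i => (t (boxQuarkEquiv.symm i).1)⁻¹ | Sum.inr i => t (boxQuarkEquiv.symm i).1) • LinearMap.proj w) (A.F U) = A.F U) → (∀ t : Fin Nf → ℂ,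 (∀ f, t f ≠ 0) → ∀ U, ExteriorAlgebra.map (LinearMap.pi fun w : BoxFermiIdx Nf R' ⊕ₗ BoxFermiIdx Nf R' => (match ofLex w with | Sum.inl i => (t (boxQuarkEquiv.symm i).1)⁻¹ | Sum.inr i => t (boxQuarkEquiv.symm i).1) • LinearMap.proj w) (B.F U) = B.F U) → ∃ C : ℝ, ∀ᶠ k in Filter.atTop, ∀ S : ℕ, sch.L k ≤ S → ∀ n : ℕ, n ≤ S → ‖qcdLatticeConnectedCorr (sch.β k) (2 * S + 1) (fun fl => sch.mq fl k) A B n‖ ≤ C * Real.exp (-(2 * Δ * (sch.a k * n)))) → sch.HasLatticeMassGap Δ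

-- earlier ThinQCD (stmt-QuantumFields-9509, replaced 2026-08-16T23:12:19Z -> stmt-QuantumFields-17278): retired by None — open Literature.MathematicalPhysics.QuantumFieldTheory in ∀ Nf : ℕ, Nf = 2 ∨ Nf = 3 → ∃ reg : QCDRegularisation Nf, reg.HasMassScaling ∧ ∀ m : Fin Nf → ℝ, (∀ f, 0 < m f) → ∃ (z shift : QCDField Nf → ℕ → ℝ) (T : OSData (QCDField Nf) 4), IsQCDAlong (reg.scheme m z shift) T ∧ (∃ f g
/-- item stmt-QuantumFields-17278 · crux · rank 3 · open · by planner
why it might fail: Open core: continuum limit for ALL m_f>0 over ONE reg (UV stability gives subsequences only), T.HasMassGap + neutral lattice gap along asymptotic scaling, AND the chiral endpoint (gap→0 as m→0⁺: Goldstone physics, no exact chiral symmetry for Wilson quarks at finite a); 3-pt clause bets on c₃(g₀)≠0.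
sources: JaffeWitten2000 §1 and §5; JaffeWittenClay2006 §6.5 with footnote 2 (weak/subsequential existence excluded), Literature.Barriers.QuantumFields.UVStabilityNonUniqueness (UVStabilityNonUniqueness_holds: convergence of even one observable is not a UV-stability consequence), Balaban1987RG1 = doi:10.1007/bf01215223; Balaban1988Convergent = doi:10.1007/bf01217741 (Cor. 3, ultraviolet stability — actions, not observables), MontvayMunster1994 §5.1 (m_crit, Z_m, Wilson quark masses; plaquette–ψ̄ψ mixing); p.239 (5.59)–(5.60): the critical line is where the renormalised quark mass and, by the Goldstone theorem, the pion mass vanish — the chiral-endpoint clause; (5.84) RGI mass, Literature.MathematicalPhysics.QuantumFieldTheory.QCDRegularisation.IsChiralAtZero (statement re-type p117723; probes docs/m5/audits/retype-2026-08-16/qcd/: isChiralAtZero_shift_iff, shifted_not_chiral), LuscherWeisz2011 = doi:10.1007/jhep02(2011)051 (perturbative gradient-flow window)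
[crux] THE THIN CONJUNCT (card NET; re-typed 2026-08-16 with the Statement, p117723). For N_f = 2
and N_f = 3: one mass-independent regularisation reg with `HasMassScaling` AND CHIRAL AT ZERO —
`reg.IsChiralAtZero` verbatim from the re-typed `QCDOf`: for every ε > 0 some POSITIVE mass tuple m
has no uniform lattice gap ε (`¬ (reg.scheme m 0 0).HasLatticeMassGap ε`), i.e. the lattice gap
closes as m → 0⁺, pinning the flavour-blind additive offset of m_crit to the chiral point — such
that for every tuple m_f > 0 there are z, shift and OS data T with `IsQCDAlong (reg.scheme m z
shift) T`; lattice-side UV non-degeneracy — for the renormalised smeared `glue` field and for each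
`pseudoRe f₁ f₂` (f₁ ≠ f₂) a pair of real bumps f (times < 0), g (times > 0) whose connected lattice
2-point function stays ≥ ε > 0 eventually in k, and for `glue` a triple f, g, h in the time slabs
(−∞,0), (0,1), (1,∞) whose connected lattice 3-point function stays ≥ ε; and one Δ > 0 with
`T.HasMassGap Δ` and FLAVOUR-NEUTRAL lattice clustering at rate 2Δ (the neutral restriction of
`HasLatticeMassGap`). This is the re-typed `QCDOf` with every flavoured/baryonic lattice GAP
obligation removed and the soft clauses -/
@[route_item "route-QuantumFields-QuarksNoInfraredClause", crux]
def ThinQCD : Prop :=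
  open Literature.MathematicalPhysics.QuantumFieldTheory in ∀ Nf : ℕ, Nf = 2 ∨ Nf = 3 → ∃ reg : QCDRegularisation Nf, reg.HasMassScaling ∧ reg.IsChiralAtZero ∧ ∀ m : Fin Nf → ℝ, (∀ f, 0 < m f) → ∃ (z shift : QCDField Nf → ℕ → ℝ) (T : OSData (QCDField Nf) 4), IsQCDAlong (reg.scheme m z shift) T ∧ (∃ f g : SchwartzMap (EuclideanSpace ℝ (Fin 4)) ℝ, tsupport (f : EuclideanSpace ℝ (Fin 4) → ℝ) ⊆ {x | x 0 < 0} ∧ tsupport (g : EuclideanSpace ℝ (Fin 4) → ℝ) ⊆ {x | 0 < x 0} ∧ ∃ ε > (0 : ℝ), ∀ᶠ k in Filter.atTop, ε ≤ ‖qcdLatticeSchwinger (reg.scheme m z shift) k 2 ![QCDField.glue, QCDField.glue] ![f, g] - qcdLatticeSchwinger (reg.scheme m z shift) k 1 ![QCDField.glue] ![f] * qcdLatticeSchwinger (reg.scheme m z shift) k 1 ![QCDField.glue] ![g]‖) ∧ (∀ f₁ f₂ : Fin Nf, f₁ ≠ f₂ → (∃ f g : SchwartzMap (EuclideanSpace ℝ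 (Fin 4)) ℝ, tsupport (f : EuclideanSpace ℝ (Fin 4) → ℝ) ⊆ {x | x 0 < 0} ∧ tsupport (g : EuclideanSpace ℝ (Fin 4) → ℝ) ⊆ {x | 0 < x 0} ∧ ∃ ε > (0 : ℝ), ∀ᶠ k in Filter.atTop, ε ≤ ‖qcdLatticeSchwinger (reg.scheme m z shift) k 2 ![(QCDField.pseudoRe f₁ f₂), (QCDField.pseudoRe f₁ f₂)] ![f, g] - qcdLatticeSchwinger (reg.scheme m z shift) k 1 ![(QCDField.pseudoRe f₁ f₂)] ![f] * qcdLatticeSchwinger (reg.scheme m z shift) k 1 ![(QCDField.pseudoRe f₁ f₂)] ![g]‖)) ∧ (∃ f g h : SchwartzMap (EuclideanSpace ℝ (Fin 4)) ℝ, tsupport (f : EuclideanSpace ℝ (Fin 4) → ℝ) ⊆ {x | x 0 < 0} ∧ tsupport (g : EuclideanSpace ℝ (Fin 4) → ℝ) ⊆ {x | 0 < x 0 ∧ x 0 < 1} ∧ tsupport (h : EuclideanSpace ℝ (Fin 4) → ℝ) ⊆ {x | 1 < x 0} ∧ ∃ ε > (0 : ℝ), ∀ᶠ k in Filter.atTop,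 ε ≤ ‖qcdLatticeSchwinger (reg.scheme m z shift) k 3 ![QCDField.glue, QCDField.glue, QCDField.glue] ![f, g, h] - qcdLatticeSchwinger (reg.scheme m z shift) k 1 ![QCDField.glue] ![f] * qcdLatticeSchwinger (reg.scheme m z shift) k 2 ![QCDField.glue, QCDField.glue] ![g, h] - qcdLatticeSchwinger (reg.scheme m z shift) k 1 ![QCDField.glue] ![g] * qcdLatticeSchwinger (reg.scheme m z shift) k 2 ![QCDField.glue, QCDField.glue] ![f, h] - qcdLatticeSchwinger (reg.scheme m z shift) k 1 ![QCDField.glue] ![h] * qcdLatticeSchwinger (reg.scheme m z shift) k 2 ![QCDField.glue, QCDField.glue] ![f, g] + 2 * (qcdLatticeSchwinger (reg.scheme m z shift) k 1 ![QCDField.glue] ![f] * qcdLatticeSchwinger (reg.scheme m z shift) k 1 ![QCDField.glue] ![g] * qcdLatticeSchwinger (reg.scheme m z shift) k 1 ![QCDField.glue] ![h])‖) ∧ ∃ Δ > 0, T.HasMassGap Δ ∧ (∀ (R R' : ℕ) (A : QCDLatticeObservable Nf R) (B : QCDLatticeObservable Nf R'), (∀ t : Fin Nf → ℂ, (∀ f,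 t f ≠ 0) → ∀ U, ExteriorAlgebra.map (LinearMap.pi fun w : BoxFermiIdx Nf R ⊕ₗ BoxFermiIdx Nf R => (match ofLex w with | Sum.inl i => (t (boxQuarkEquiv.symm i).1)⁻¹ | Sum.inr i => t (boxQuarkEquiv.symm i).1) • LinearMap.proj w) (A.F U) = A.F U) → (∀ t : Fin Nf → ℂ, (∀ f, t f ≠ 0) → ∀ U, ExteriorAlgebra.map (LinearMap.pi fun w : BoxFermiIdx Nf R' ⊕ₗ BoxFermiIdx Nf R' => (match ofLex w with | Sum.inl i => (t (boxQuarkEquiv.symm i).1)⁻¹ | Sum.inr i => t (boxQuarkEquiv.symm i).1) • LinearMap.proj w) (B.F U) = B.F U) → ∃ C : ℝ, ∀ᶠ k in Filter.atTop, ∀ S : ℕ, (reg.scheme m z shift).L k ≤ S → ∀ n : ℕ, n ≤ S → ‖qcdLatticeConnectedCorr ((reg.scheme m z shift).β k) (2 * S + 1) (fun fl => (reg.scheme m z shift).mq fl k) A B n‖ ≤ C * Real.exp (-(2 * Δ * ((reg.scheme m z shift).a k * n))))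

/-- item stmt-QuantumFields-9510 · support · rank 9 · closed · proved by Summit.QuantumFields.QCD.Theorems.quarksNoInfraredClause_twoPointWitness_proof (prover) · by planner
sources: OS1973 §2, GlimmJaffe1987 §6.1, Literature.MathematicalPhysics.QuantumLattice.exists_isTensorOf
[support] LIMIT GLUE FOR NON-TRIVIALITY (card P2(b)). For any scheme, OS data and species s:
`IsQCDAlong sch T` and the lattice-side 2-point non-degeneracy of s (real bumps f at negative, g at
positive times; connected lattice 2-point function ≥ ε eventually) imply `T.IsNontrivial s`. Proof
plan: F := tensorFin 1 (ofRealTest (f ∘ θ)), G := tensorFin 1 (ofRealTest g) are time-ordered;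
osAdjoint F is the tensor of ofRealTest f (f real); appendTensor gives H with IsAppendTensorOf;
disjoint closed time supports make f ⊗ g off-diagonal; IsQCDAlong (n = 1, 2) identifies the limits,
and a sequence eventually ≥ ε in norm has a non-zero limit. [difficulty: provable-now] -/
@[route_item "route-QuantumFields-QuarksNoInfraredClause"]
def TwoPointWitness : Prop :=
  open Literature.MathematicalPhysics.QuantumFieldTheory in ∀ (Nf : ℕ) (sch : QCDScheme Nf) (T : OSData (QCDField Nf) 4) (s : QCDField Nf), IsQCDAlong sch T → (∃ f g : SchwartzMap (EuclideanSpace ℝ (Fin 4)) ℝ, tsupport (f : EuclideanSpace ℝ (Fin 4) → ℝ) ⊆ {x | x 0 < 0} ∧ tsupport (g : EuclideanSpace ℝ (Fin 4) → ℝ) ⊆ {x | 0 < x 0} ∧ ∃ ε > (0 : ℝ), ∀ᶠ k in Filter.atTop, ε ≤ ‖qcdLatticeSchwinger sch k 2 ![s, s] ![f, g] - qcdLatticeSchwinger sch k 1 ![s] ![f] * qcdLatticeSchwinger sch k 1 ![s] ![g]‖) → T.IsNontrivial s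

-- `TwoPointWitness` holds: proved by `Summit.QuantumFields.QCD.Theorems.quarksNoInfraredClause_twoPointWitness_proof` (its module imports this route file, so no `_holds` link can be stated here).

/-- item stmt-QuantumFields-9511 · support · rank 9 · closed · proved by Summit.QuantumFields.QCD.Theorems.quarksNoInfraredClause_threePointWitness_proof (prover) · by planner
sources: OS1973 §2, GlimmJaffe1987 §6.1 (truncated functions), Literature.MathematicalPhysics.QuantumLattice.isTensorOf_tensorFin
[support] LIMIT GLUE FOR NON-GAUSSIANITY (card P2(c)). For any scheme, OS data and species s:
`IsQCDAlong sch T` and the lattice-side connected 3-point non-degeneracy of s (real bumps in the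
slabs x⁰ < 0, 0 < x⁰ < 1, 1 < x⁰; κ₃ combination ≥ ε eventually) imply `T.IsNonGaussian s`
(witnesses: ofRealTest f, g, h and their tensorFin tensors; pairwise disjoint closed supports give
off-diagonality of the 3- and 2-tensors; IsQCDAlong for n = 1, 2, 3). [difficulty: provable-now] -/
@[route_item "route-QuantumFields-QuarksNoInfraredClause"]
def ThreePointWitness : Prop :=
  open Literature.MathematicalPhysics.QuantumFieldTheory in ∀ (Nf : ℕ) (sch : QCDScheme Nf) (T : OSData (QCDField Nf) 4) (s : QCDField Nf), IsQCDAlong sch T → (∃ f g h : SchwartzMap (EuclideanSpace ℝ (Fin 4)) ℝ, tsupport (f : EuclideanSpace ℝ (Fin 4) → ℝ) ⊆ {x | x 0 < 0} ∧ tsupport (g : EuclideanSpace ℝ (Fin 4) → ℝ) ⊆ {x | 0 < x 0 ∧ x 0 < 1} ∧ tsupport (h : EuclideanSpace ℝ (Fin 4) → ℝ) ⊆ {x | 1 < x 0} ∧ ∃ ε > (0 : ℝ), ∀ᶠ k in Filter.atTop, ε ≤ ‖qcdLatticeSchwinger sch k 3 ![s, s, s] ![f, g, h] - qcdLatticeSchwinger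 sch k 1 ![s] ![f] * qcdLatticeSchwinger sch k 2 ![s, s] ![g, h] - qcdLatticeSchwinger sch k 1 ![s] ![g] * qcdLatticeSchwinger sch k 2 ![s, s] ![f, h] - qcdLatticeSchwinger sch k 1 ![s] ![h] * qcdLatticeSchwinger sch k 2 ![s, s] ![f, g] + 2 * (qcdLatticeSchwinger sch k 1 ![s] ![f] * qcdLatticeSchwinger sch k 1 ![s] ![g] * qcdLatticeSchwinger sch k 1 ![s] ![h])‖) → T.IsNonGaussian s

-- `ThreePointWitness` holds: proved by `Summit.QuantumFields.QCD.Theorems.quarksNoInfraredClause_threePointWitness_proof` (its module imports this route file, so no `_holds` link can be stated here).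

/-- item stmt-QuantumFields-9512 · assembly · rank 1 · closed · proved by Summit.QuantumFields.QCD.Theorems.quarksNoInfraredClause_assembly_proof (prover) · by planner
sources: JaffeWitten2000 §5, Haag1996 Thm II.5.4.1
[assembly] TorusHalfSpectrum → TwoPointWitness → ThreePointWitness → ThinQCD → QCD (the conjunct
`QCD := QCDOf 2 ∧ QCDOf 3` of Summits/QuantumFields/QCD/Statement.lean). -/
@[route_item "route-QuantumFields-QuarksNoInfraredClause"]
def Assembly : Prop :=
  TorusHalfSpectrum → TwoPointWitness → ThreePointWitness → ThinQCD → QCD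

-- `Assembly` holds: proved by `Summit.QuantumFields.QCD.Theorems.quarksNoInfraredClause_assembly_proof` (its module imports this route file, so no `_holds` link can be stated here).

/-! D-0027 §2.1 — DECIDING THEOREM (planner-authored via `route open/edit --closes-file`; by planner-rbadge-QuantumFields-QuarksNoInfraredC-63acabcd-g2-0 2026-08-16T23:41:07Z):
its hypotheses are this route's items and its conclusion the sub-problem Statement (glue_lint), and it elaborates with this file. -/

/-- **Deciding theorem (D-0027 §2.1), crux-only.** HALF and THIN (re-typed 2026-08-16 with
`reg.IsChiralAtZero`) give `QCD`; the support items `TwoPointWitness`/`ThreePointWitness` (limit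
glue: tensors of real bumps in disjoint time slabs are off-diagonal, `IsQCDAlong` identifies the
limits, an eventually-`≥ ε` sequence has a non-zero limit) are PROVED inside (`h₃`, `h₄`). -/
@[closes "route-QuantumFields-QuarksNoInfraredClause"] theorem closes : TorusHalfSpectrum → ThinQCD → QCD := by
  intro h₁ h₂
  let oR : SchwartzMap (EuclideanSpace ℝ (Fin 4)) ℝ →L[ℝ] SchwartzMap (EuclideanSpace ℝ (Fin 4)) ℂ := Literature.MathematicalPhysics.QuantumLattice.ofRealTest
  let tF : (n : ℕ) → (Fin n → SchwartzMap (EuclideanSpace ℝ (Fin 4)) ℝ) → SchwartzMap (Fin n → EuclideanSpace ℝ (Fin 4)) ℂ :=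
    fun n f => SchwartzMap.tensorFin n fun i => oR (f i)
  have hsupp : ∀ {n : ℕ} (f : Fin n → SchwartzMap (EuclideanSpace ℝ (Fin 4)) ℝ) {x}, x ∈ tsupport (tF n f) → ∀ i, x i ∈ tsupport (f i) := by
    intro n f x hx i
    by_contra hi
    have h1 : ∀ᶠ y in 𝓝 x, f i (y i) = 0 :=
      ((continuous_apply i).tendsto x).eventually (notMem_tsupport_iff_eventuallyEq.mp hi)
    refine (notMem_tsupport_iff_eventuallyEq.mpr ?_) hx
    filter_upwards [h1] with y hy
    simp only [tF, oR, Pi.zero_apply, SchwartzMap.tensorFin_apply, Literature.MathematicalPhysics.QuantumLattice.ofRealTest_apply]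
    exact Finset.prod_eq_zero (Finset.mem_univ i) (by rw [hy]; simp)
  have hoff : ∀ {n : ℕ} (f : Fin n → SchwartzMap (EuclideanSpace ℝ (Fin 4)) ℝ),
      (∀ i j, i ≠ j → ∀ z, z ∈ tsupport (f i) → z ∈ tsupport (f j) → False) →
      Literature.MathematicalPhysics.AQFT.IsOffDiagonal (tF n f) :=
    fun f hsep => Literature.MathematicalPhysics.AQFT.IsOffDiagonal.of_tsupport_subset fun x hx hmem => by
      obtain ⟨i, j, hij, hxij⟩ := hmem
      exact hsep i j hij (x i) (hsupp f hx i) (hxij ▸ hsupp f hx j)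
  have hoff1 : ∀ a : SchwartzMap (EuclideanSpace ℝ (Fin 4)) ℝ, Literature.MathematicalPhysics.AQFT.IsOffDiagonal (tF 1 ![a]) :=
    fun a => hoff ![a] fun i j hij _ _ _ => hij (Subsingleton.elim i j)
  have hoff2 : ∀ a b : SchwartzMap (EuclideanSpace ℝ (Fin 4)) ℝ, (∀ z, z ∈ tsupport a → z ∈ tsupport b → False) →
      Literature.MathematicalPhysics.AQFT.IsOffDiagonal (tF 2 ![a, b]) := by
    intro a b hab
    refine hoff ![a, b] fun i j hij z hzi hzj => ?_
    fin_cases i <;> fin_cases j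
    · exact hij rfl
    · exact hab z hzi hzj
    · exact hab z hzj hzi
    · exact hij rfl
  have hto : ∀ g : SchwartzMap (EuclideanSpace ℝ (Fin 4)) ℝ, tsupport g ⊆ {x | 0 < x 0} → Literature.MathematicalPhysics.QuantumLattice.IsTimeOrdered (tF 1 ![g]) := by
    intro g hg x hx
    refine ⟨fun i => ?_, fun i j hij => absurd (Fin.lt_def.mp hij) (by omega)⟩
    have h := hsupp ![g] hx i
    simp only [Matrix.cons_val_fin_one] at h
    exact hg h
  have hsl : ∀ (a b : SchwartzMap (EuclideanSpace ℝ (Fin 4)) ℝ) (P Q : ℝ → Prop), tsupport a ⊆ {x | P (x 0)} → tsupport b ⊆ {x | Q (x 0)} →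
      (∀ t, P t → Q t → False) → ∀ z, z ∈ tsupport a → z ∈ tsupport b → False :=
    fun a b P Q ha hb hPQ z h1 h2 => hPQ _ (ha h1) (hb h2)
  have hs3 : ∀ {ι : Type} (s : ι), (![s, s, s] : Fin 3 → ι) = fun _ => s := fun s => by
    funext i; fin_cases i <;> rfl
  have hs2 : ∀ {ι : Type} (s : ι), (![s, s] : Fin 2 → ι) = fun _ => s := fun s => by
    funext i; fin_cases i <;> rfl
  have hs1 : ∀ {ι : Type} (s : ι), (![s] : Fin 1 → ι) = fun _ => s := fun s => by
    funext i; fin_cases i; rfl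
  have hT : ∀ {n : ℕ} (f : Fin n → SchwartzMap (EuclideanSpace ℝ (Fin 4)) ℝ) (fc : Fin n → SchwartzMap (EuclideanSpace ℝ (Fin 4)) ℂ),
      (∀ i, fc i = oR (f i)) → Literature.MathematicalPhysics.QuantumLattice.IsTensorOf (tF n f) fc := fun f fc hfc x => by
    rw [SchwartzMap.tensorFin_apply]
    exact Finset.prod_congr rfl fun i _ => by rw [hfc i]
  have hlim1 : ∀ {Nf : ℕ} (sch : Literature.MathematicalPhysics.QuantumFieldTheory.QCDScheme Nf) T (s : Literature.MathematicalPhysics.QuantumFieldTheory.QCDField Nf), Literature.MathematicalPhysics.QuantumFieldTheory.IsQCDAlong sch T →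
      ∀ a : SchwartzMap (EuclideanSpace ℝ (Fin 4)) ℝ, Tendsto (fun k => Literature.MathematicalPhysics.QuantumFieldTheory.qcdLatticeSchwinger sch k 1 ![s] ![a]) atTop
        (𝓝 (T.schwinger 1 ![s] (tF 1 ![a]))) :=
    fun sch T s hqcd a => hqcd.2.2 1 one_ne_zero ![s] ![a] _ (Literature.MathematicalPhysics.QuantumLattice.isTensorOf_tensorFin _) (hoff1 a)
  have hlim2 : ∀ {Nf : ℕ} (sch : Literature.MathematicalPhysics.QuantumFieldTheory.QCDScheme Nf) T (s : Literature.MathematicalPhysics.QuantumFieldTheory.QCDField Nf), Literature.MathematicalPhysics.QuantumFieldTheory.IsQCDAlong sch T →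
      ∀ a b : SchwartzMap (EuclideanSpace ℝ (Fin 4)) ℝ, (∀ z, z ∈ tsupport a → z ∈ tsupport b → False) →
      Tendsto (fun k => Literature.MathematicalPhysics.QuantumFieldTheory.qcdLatticeSchwinger sch k 2 ![s, s] ![a, b]) atTop
        (𝓝 (T.schwinger 2 ![s, s] (tF 2 ![a, b]))) :=
    fun sch T s hqcd a b hab =>
      hqcd.2.2 2 two_ne_zero ![s, s] ![a, b] _ (Literature.MathematicalPhysics.QuantumLattice.isTensorOf_tensorFin _) (hoff2 a b hab)
  -- support item TwoPointWitness, proved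
  have h₃ : TwoPointWitness := by
    intro Nf sch T s hqcd hw
    obtain ⟨f, g, hf, hg, ε, hε, hev⟩ := hw
    have hfg := hsl f g (· < 0) (0 < ·) hf hg fun t a b => by linarith
    let F := tF 1 ![Literature.MathematicalPhysics.QuantumLattice.thetaTest 4 f]
    have hadj : Literature.MathematicalPhysics.QuantumLattice.osAdjoint F = tF 1 ![f] := by
      ext x
      rw [Literature.MathematicalPhysics.QuantumLattice.osAdjoint_apply]
      simp [F, tF, oR, SchwartzMap.tensorFin_apply, Literature.MathematicalPhysics.QuantumLattice.thetaTest_apply,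
        Literature.MathematicalPhysics.QuantumLattice.timeReflection_timeReflection]
    have hH : Literature.MathematicalPhysics.QuantumLattice.IsAppendTensorOf (n := 1) (m := 1) (tF 2 ![f, g]) (Literature.MathematicalPhysics.QuantumLattice.osAdjoint F) (tF 1 ![g]) := by
      intro x
      rw [hadj]
      simp [tF, SchwartzMap.tensorFin_apply, Fin.prod_univ_two]
    have hFto : Literature.MathematicalPhysics.QuantumLattice.IsTimeOrdered F := by
      refine hto _ fun x hx => ?_
      have hx' : x ∈ tsupport (fun y => f (Literature.MathematicalPhysics.QuantumLattice.timeReflection 4 y)) := by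
        have : ((Literature.MathematicalPhysics.QuantumLattice.thetaTest 4 f : SchwartzMap (EuclideanSpace ℝ (Fin 4)) ℝ) : EuclideanSpace ℝ (Fin 4) → ℝ) = fun y => f (Literature.MathematicalPhysics.QuantumLattice.timeReflection 4 y) :=
          funext fun y => Literature.MathematicalPhysics.QuantumLattice.thetaTest_apply 4 f y
        rwa [this] at hx
      have h := hf (Literature.MathematicalPhysics.QuantumLattice.tsupport_schwartz_comp_subset f (Literature.MathematicalPhysics.QuantumLattice.timeReflection 4).continuous hx')
      simp [Literature.MathematicalPhysics.QuantumLattice.timeReflection_apply] at h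
      exact h
    have hlim := (hlim2 sch T s hqcd f g hfg).sub ((hlim1 sch T s hqcd f).mul (hlim1 sch T s hqcd g))
    have hle := ge_of_tendsto hlim.norm hev
    have hne : T.schwinger 2 ![s, s] (tF 2 ![f, g]) -
        T.schwinger 1 ![s] (tF 1 ![f]) * T.schwinger 1 ![s] (tF 1 ![g]) ≠ 0 := by
      intro h0; rw [h0, norm_zero] at hle; linarith
    rw [hs2 s, hs1 s] at hne
    refine ⟨F, tF 1 ![g], tF 2 ![f, g], hFto, hto g hg, hH, ?_⟩
    change T.schwinger 2 (fun _ => s) (tF 2 ![f, g]) ≠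
      T.schwinger 1 (fun _ => s) (Literature.MathematicalPhysics.QuantumLattice.osAdjoint F) * T.schwinger 1 (fun _ => s) (tF 1 ![g])
    rw [hadj]
    exact sub_ne_zero.mp hne
  -- support item ThreePointWitness, proved
  have h₄ : ThreePointWitness := by
    intro Nf sch T s hqcd hw
    obtain ⟨f, g, h, hf, hg, hh, ε, hε, hev⟩ := hw
    have hfg := hsl f g (· < 0) (fun t => 0 < t ∧ t < 1) hf hg fun t a b => by linarith [b.1]
    have hfh := hsl f h (· < 0) (1 < ·) hf hh fun t a b => by linarith
    have hgh := hsl g h (fun t => 0 < t ∧ t < 1) (1 < ·) hg hh fun t a b => by linarith [a.2]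
    have h3off : Literature.MathematicalPhysics.AQFT.IsOffDiagonal (tF 3 ![f, g, h]) := by
      refine hoff ![f, g, h] fun i j hij z hzi hzj => ?_
      fin_cases i <;> fin_cases j
      · exact hij rfl
      · exact hfg z hzi hzj
      · exact hfh z hzi hzj
      · exact hfg z hzj hzi
      · exact hij rfl
      · exact hgh z hzi hzj
      · exact hfh z hzj hzi
      · exact hgh z hzj hzi
      · exact hij rfl
    have L3 : Tendsto (fun k => Literature.MathematicalPhysics.QuantumFieldTheory.qcdLatticeSchwinger sch k 3 ![s, s, s] ![f, g, h]) atTop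
        (𝓝 (T.schwinger 3 ![s, s, s] (tF 3 ![f, g, h]))) :=
      hqcd.2.2 3 (by norm_num) ![s, s, s] ![f, g, h] _ (Literature.MathematicalPhysics.QuantumLattice.isTensorOf_tensorFin _) h3off
    have L2 := hlim2 sch T s hqcd
    have L1 := hlim1 sch T s hqcd
    have hlim := (((L3.sub ((L1 f).mul (L2 g h hgh))).sub ((L1 g).mul (L2 f h hfh))).sub
      ((L1 h).mul (L2 f g hfg))).add ((((L1 f).mul (L1 g)).mul (L1 h)).const_mul 2)
    have hle := ge_of_tendsto hlim.norm hev
    have hne : T.schwinger 3 ![s, s, s] (tF 3 ![f, g, h])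
        - T.schwinger 1 ![s] (tF 1 ![f]) * T.schwinger 2 ![s, s] (tF 2 ![g, h])
        - T.schwinger 1 ![s] (tF 1 ![g]) * T.schwinger 2 ![s, s] (tF 2 ![f, h])
        - T.schwinger 1 ![s] (tF 1 ![h]) * T.schwinger 2 ![s, s] (tF 2 ![f, g])
        + 2 * (T.schwinger 1 ![s] (tF 1 ![f]) * T.schwinger 1 ![s] (tF 1 ![g]) *
          T.schwinger 1 ![s] (tF 1 ![h])) ≠ 0 := by
      intro h0; rw [h0, norm_zero] at hle; linarith
    rw [hs3 s, hs2 s, hs1 s] at hne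
    refine ⟨oR f, oR g, oR h, tF 3 ![f, g, h], tF 2 ![g, h], tF 2 ![f, h], tF 2 ![f, g],
      tF 1 ![f], tF 1 ![g], tF 1 ![h], hT _ _ fun i => ?_, h3off, hT _ _ fun i => ?_,
      hT _ _ fun i => ?_, hT _ _ fun i => ?_, hT _ _ fun i => ?_, hT _ _ fun i => ?_,
      hT _ _ fun i => ?_, ?_⟩
    all_goals first | (fin_cases i <;> rfl) | exact hne
  -- assembly of the conjunct
  have key : ∀ Nf : ℕ, Nf = 2 ∨ Nf = 3 → QCDOf Nf := by
    intro Nf hNf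
    have hb : 0 < Literature.MathematicalPhysics.QuantumFieldTheory.betaCoeff₀ Nf := by
      rcases hNf with rfl | rfl <;>
        · unfold Literature.MathematicalPhysics.QuantumFieldTheory.betaCoeff₀; positivity
    obtain ⟨reg, hms, hchi, H⟩ := h₂ Nf hNf
    refine ⟨reg, hms, hchi, fun m hm => ?_⟩
    obtain ⟨z, shift, T, hqcd, h2g, h2fg, h3g, Δ, hΔ, hT, hN⟩ := H m hm
    exact ⟨z, shift, T, hqcd, h₃ _ _ _ _ hqcd h2g, h₄ _ _ _ _ hqcd h3g,
      fun f g hfg => h₃ _ _ _ _ hqcd (h2fg f g hfg), Δ, hΔ, hT,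
      h₁ _ _ _ hΔ hb hqcd.1 hqcd.2.1 hN⟩
  exact ⟨key 2 (Or.inl rfl), key 3 (Or.inr rfl)⟩

end Summit.QuantumFields.QCD.Theses.QuarksNoInfraredClause
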